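import Literature.Analysis.FluidPDE.PeriodicLerayGalerkinEnergy
import Literature.Analysis.ODE.PeriodicDissipative
import HarnessLib

/-!
# [BT1] Lemma 2.6: `T`-periodic Galerkin approximations of the mollified perturbed Leray system

Analysis/FluidPDE proof file (theorems only), third layer under the named fact
`Literature.Analysis.FluidPDE.bradshawTsai2017_thm_2_4_mollified` (`PeriodicLerayExistence`):

> **Bradshaw–Tsai, Ann. Henri Poincaré 18 (2017) = arXiv:1510.07504 [BT1], Lemma 2.6
> (Construction of Galerkin approximations).** Fix `T > 0` and let `W` satisfy the conclusions of
> Lemma 2.5 with `α = 1/4`. 1. For any `k ∈ ℕ` and `ε > 0`, the system of ODEs (eq:ODE) has a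
> `T`-periodic solution `b_k ∈ H¹(0,T)`. 2. Letting `U_k(y,s) = Σᵢ b_{ki}(s) aᵢ(y)`, we have
> `‖U_k‖_{L^∞(0,T;L²(ℝ³))} + ‖U_k‖_{L²(0,T;H¹(ℝ³))} < C` where `C` is independent of both `ε`
> and `k`.

`bradshawTsai2017_lemma_2_6` proves this over the Galerkin system of `PeriodicLerayGalerkinSystem`
(`galerkinRHS W η_ε a`, `η_ε = BradshawTsai2019.scaledMollifier η ε`) for every finite
`L²`-orthonormal family `a` of divergence-free test fields (the printed `{a_k} ⊂ 𝒱`, an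
orthonormal basis of `H`, enters Lemma 2.6 only through its first `k` members), with the
smallness "`α = 1/4`" replaced by "`α ≤ α₀`" for the absolute `α₀` of
`exists_galerkin_energy_bound` (see the design note of `PeriodicLerayExistence` on `α = 1/4`
versus `α ≤ α₀`): there is `C = C(T, W)`, independent of `ε`, `k` and the family, and a global
`C¹` solution `b` of the Galerkin system with `b(s + T) = b(s)`,
`‖U_k(s)‖²_{L²} = ‖b(s)‖² ≤ C` for all `s`, and `∫₀ᵀ ‖∇U_k‖²_{L²} ≤ C`.

Proof as printed: the energy inequality `½ d/ds‖U_k‖² ≤ C₂ − ¼‖U_k‖² − ¾‖∇U_k‖²`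
(`exists_galerkin_energy_bound` with `inner_galerkinRHS_eq_galerkinForm`) makes the Galerkin
field dissipative, so the period map has a fixed point in the absorbing ball by Brouwer's theorem
(`ODE.exists_periodic_solution_of_dissipative`, which packages "`T̃ = T`", Gronwall, "Let
`T : B_ρ^k → B_ρ^k` map `b_k(0) → b_k(T)` … Brouwer", and the periodic extension); integrating
the energy inequality over a period gives the `L²H¹` bound ("Integrating (ineq:kenergyevolution)
in `s ∈ [0,T]` and using `U_k(0) = U_k(T)`").

## References

* Z. Bradshaw, T.-P. Tsai, Ann. Henri Poincaré 18 (2017) = arXiv:1510.07504, Lemma 2.6 and its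
  proof [BradshawTsai2017AHP].
-/

noncomputable section

open MeasureTheory Set Function Filter Topology TopologicalSpace Metric Module
open scoped NNReal ENNReal InnerProductSpace RealInnerProductSpace Convolution ContDiff

namespace Literature.Analysis.FluidPDE

/-- Local notation for physical space `ℝ³ = EuclideanSpace ℝ (Fin 3)`. -/
local notation "ℝ³" => EuclideanSpace ℝ (Fin 3)

namespace BradshawTsai2017

variable {k : ℕ}

/-! ## The kernel `η_ε` -/

/-- The scaled kernel `η_ε` of a mollifying kernel is smooth. [folklore] -/
theorem contDiff_scaledMollifier {η : ℝ³ → ℝ} (hη : IsMollifyingKernel η) (ε : ℝ) :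
    ContDiff ℝ (⊤ : ℕ∞) (BradshawTsai2019.scaledMollifier η ε) := by
  have e : BradshawTsai2019.scaledMollifier η ε =
      fun y => (ε ^ finrank ℝ ℝ³)⁻¹ * η (ε⁻¹ • y) := rfl
  rw [e]
  exact contDiff_const.mul (hη.contDiff.comp (contDiff_const_smul _))

/-- The scaled kernel `η_ε`, `ε > 0`, of a mollifying kernel has compact support. [folklore] -/
theorem hasCompactSupport_scaledMollifier' {η : ℝ³ → ℝ} (hη : IsMollifyingKernel η) {ε : ℝ}
    (hε : 0 < ε) : HasCompactSupport (BradshawTsai2019.scaledMollifier η ε) := by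
  have e : BradshawTsai2019.scaledMollifier η ε =
      fun y => (ε ^ finrank ℝ ℝ³)⁻¹ * η (ε⁻¹ • y) := rfl
  rw [e]
  exact (hη.hasCompactSupport.comp_smul (inv_ne_zero hε.ne')).mul_left

/-! ## Continuity lemmas along a solution -/

/-- Along a continuous curve `b`, a field continuous in `s` and Lipschitz in `x` on a ball
containing the curve (uniformly in `s`) is continuous: `s ↦ v s (b s)`. [folklore] -/
theorem continuous_field_comp {E : Type*} [NormedAddCommGroup E] {v : ℝ → E → E} {b : ℝ → E}
    (hb : Continuous b) {R : ℝ} (hR : ∀ s, b s ∈ closedBall (0 : E) R) {K : ℝ≥0}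
    (hlip : ∀ s, LipschitzOnWith K (v s) (closedBall 0 R)) (hcont : ∀ x, Continuous fun s => v s x) :
    Continuous fun s => v s (b s) := by
  refine continuous_iff_continuousAt.2 fun s₀ => ?_
  have h1 : Tendsto (fun s => v s (b s) - v s (b s₀)) (𝓝 s₀) (𝓝 0) := by
    have hdist : ∀ s, ‖v s (b s) - v s (b s₀)‖ ≤ K * ‖b s - b s₀‖ := fun s => by
      rw [← dist_eq_norm, ← dist_eq_norm]
      exact (hlip s).dist_le_mul _ (hR s) _ (hR s₀)
    have h0 : Tendsto (fun s => (K : ℝ) * ‖b s - b s₀‖) (𝓝 s₀) (𝓝 0) := by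
      have hc : Continuous fun s => (K : ℝ) * ‖b s - b s₀‖ :=
        continuous_const.mul (hb.sub (continuous_const (y := b s₀))).norm
      have := hc.tendsto s₀
      simpa using this
    exact tendsto_zero_iff_norm_tendsto_zero.2
      (squeeze_zero (fun s => norm_nonneg _) hdist h0)
  have h2 : Tendsto (fun s => v s (b s₀)) (𝓝 s₀) (𝓝 (v s₀ (b s₀))) := (hcont (b s₀)).tendsto s₀
  have h3 := h1.add h2
  simp only [sub_add_cancel, zero_add] at h3
  exact h3

/-- **Continuity of the dissipation along a continuous coefficient curve**:
`s ↦ ∫ |∇(Σᵢ bᵢ(s) aᵢ)|²` is continuous for test fields `aᵢ`. [folklore] -/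
theorem continuous_dissipation_galerkinSum {a : Fin k → ℝ³ → ℝ³}
    (ha : ∀ i, FunctionSpaces.IsTestFunctionOn (⊤ : Opens ℝ³) (a i)) {b : ℝ → EuclideanSpace ℝ (Fin k)}
    (hb : Continuous b) :
    Continuous fun s => ∫ y, frobeniusNormSq (fderiv ℝ (galerkinSum a (b s)) y) := by
  have ha1 : ∀ i, ContDiff ℝ 1 (a i) := fun i => (ha i).contDiff.of_le (by exact_mod_cast le_top)
  have had : ∀ i, Differentiable ℝ (a i) := fun i => (ha1 i).differentiable one_ne_zero
  -- joint continuity of the integrand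
  have hj : Continuous (uncurry fun s y => frobeniusNormSq (fderiv ℝ (galerkinSum a (b s)) y)) := by
    have e : (uncurry fun s y => frobeniusNormSq (fderiv ℝ (galerkinSum a (b s)) y)) =
        fun z : ℝ × ℝ³ => frobeniusNormSq (∑ i, b z.1 i • fderiv ℝ (a i) z.2) := by
      funext z; simp only [uncurry, fderiv_galerkinSum had]
    rw [e]
    refine continuous_frobeniusNormSq_comp (continuous_finsetSum _ fun i _ => ?_)
    have hbi : Continuous fun z : ℝ × ℝ³ => b z.1 i :=
      (PiLp.continuous_apply 2 _ i).comp (hb.comp continuous_fst)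
    exact hbi.smul (((ha1 i).continuous_fderiv one_ne_zero).comp continuous_snd)
  -- support in the compact set `⋃ tsupport aᵢ`
  have hK : IsCompact (⋃ i, tsupport (a i)) := isCompact_iUnion fun i => (ha i).hasCompactSupport
  have h := continuous_parametric_integral_of_continuous (μ := (volume : Measure ℝ³)) hj hK
  refine h.congr fun s => ?_
  refine setIntegral_eq_integral_of_forall_compl_eq_zero fun y hy => ?_
  simp only [mem_iUnion, not_exists] at hy
  have : fderiv ℝ (galerkinSum a (b s)) y = 0 := by
    ext1 v
    rw [fderiv_galerkinSum_apply had, zero_apply]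
    exact Finset.sum_eq_zero fun i _ => by
      rw [fderiv_of_notMem_tsupport ℝ (hy i), zero_apply, smul_zero]
  simp [this]

/-! ## Lemma 2.6 -/

/-- **[BT1] Lemma 2.6 (Construction of Galerkin approximations).** "Fix `T > 0` and let `W`
satisfy the conclusions of Lemma 2.5 with `α = 1/4` [here: `α ≤ α₀`, `α₀ ∈ (0,1)` absolute].
1. For any `k ∈ ℕ` and `ε > 0`, the system of ODEs
`d/ds b_{kj} = Σᵢ A_{ij} b_{ki} + Σ_{i,l} B_{ilj} b_{ki} b_{kl} + C_j` has a `T`-periodic solution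
`b_k ∈ H¹(0,T)`. 2. Letting `U_k(y,s) = Σᵢ b_{ki}(s) aᵢ(y)`, we have
`‖U_k‖_{L^∞(0,T;L²(ℝ³))} + ‖U_k‖_{L²(0,T;H¹(ℝ³))} < C` where `C` is independent of both `ε` and
`k`." Rendering: for every finite `L²`-orthonormal family `a` of divergence-free test fields
(the first `k` members of "`{a_k} ⊂ 𝒱` … an orthonormal basis of `H`") and every `ε > 0` there
is a global `C¹` solution `b` of the Galerkin system `galerkinRHS W η_ε a`
(`η_ε = BradshawTsai2019.scaledMollifier η ε`) with `b(s + T) = b(s)`,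
`‖U_k(s)‖²_{L²} ≤ C` for every `s` and `∫₀ᵀ ‖∇U_k(s)‖²_{L²} ds ≤ C`, the constant `C` depending
only on `T` and `W`. [cite: BradshawTsai2017AHP, Lemma 2.6] -/
theorem bradshawTsai2017_lemma_2_6 :
    ∃ α₀ : ℝ, 0 < α₀ ∧ α₀ < 1 ∧
    ∀ {T : ℝ}, 0 < T → ∀ {α : ℝ}, 0 < α → α ≤ α₀ → ∀ {W : ℝ → ℝ³ → ℝ³},
      IsRevisedProfile T (10 / 3) α W → ∀ {η : ℝ³ → ℝ}, IsMollifyingKernel η →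
        ∃ C : ℝ≥0, ∀ {ε : ℝ}, 0 < ε → ∀ {k : ℕ} {a : Fin k → ℝ³ → ℝ³},
          (∀ i, FunctionSpaces.IsTestFunctionOn (⊤ : Opens ℝ³) (a i)) →
          (∀ i, VectorCalculus.IsDivFree (a i)) →
          (∀ i j, ∫ y, ⟪a i y, a j y⟫ = if i = j then (1 : ℝ) else 0) →
          ∃ b : ℝ → EuclideanSpace ℝ (Fin k),
            (∀ s, HasDerivAt b (galerkinRHS W (BradshawTsai2019.scaledMollifier η ε) a s (b s)) s) ∧
            (∀ s, b (s + T) = b s) ∧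
            (∀ s, ∫ y, ‖galerkinSum a (b s) y‖ ^ 2 ≤ C) ∧
            ∫ s in (0 : ℝ)..T, (∫ y, frobeniusNormSq (fderiv ℝ (galerkinSum a (b s)) y)) ≤ C := by
  obtain ⟨α₀, hα₀, hα₀1, hE⟩ := exists_galerkin_energy_bound
  refine ⟨α₀, hα₀, hα₀1, ?_⟩
  intro T hT α hα hαle W hW η hη
  obtain ⟨C₂, hC₂, hbound⟩ := hE hW hα.le hαle
  -- the constant: `‖U_k(s)‖² ≤ 4C₂`, `∫₀ᵀ‖∇U_k‖² ≤ (4/3) C₂ T`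
  refine ⟨Real.toNNReal (max (4 * C₂) (4 / 3 * C₂ * T)), ?_⟩
  intro ε hε k a ha hdiv hon
  set ρ : ℝ³ → ℝ := BradshawTsai2019.scaledMollifier η ε with hρdef
  have hρ : ContDiff ℝ (⊤ : ℕ∞) ρ := contDiff_scaledMollifier hη ε
  have hρc : HasCompactSupport ρ := hasCompactSupport_scaledMollifier' hη hε
  have hρcont : Continuous ρ := hρ.continuous
  have hac : ∀ i, Continuous (a i) := fun i => (ha i).contDiff.continuous
  have has : ∀ i, HasCompactSupport (a i) := fun i => (ha i).hasCompactSupport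
  have had : ∀ i, Differentiable ℝ (a i) := fun i =>
    ((ha i).contDiff.of_le (by exact_mod_cast le_top) : ContDiff ℝ 1 (a i)).differentiable one_ne_zero
  -- the Galerkin field and its hypotheses
  set v : ℝ → EuclideanSpace ℝ (Fin k) → EuclideanSpace ℝ (Fin k) := galerkinRHS W ρ a with hvdef
  have hper : ∀ s x, v (s + T) x = v s x := fun s x => galerkinRHS_add_period hW.periodic s x
  have hlip : ∀ R : ℝ, ∃ K : ℝ≥0, ∀ s, LipschitzOnWith K (v s) (closedBall 0 R) := fun R =>
    exists_lipschitzOnWith_galerkinRHS hT hW.contDiff hW.periodic ha ρ R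
  have hcont : ∀ x, Continuous fun s => v s x := fun x => continuous_galerkinRHS hW.contDiff ha x
  -- the energy inequality along the field: `⟪v s x, x⟫ ≤ C₂ - ¼‖x‖² - ¾ D`
  have henergy : ∀ s x, ⟪v s x, x⟫ ≤ C₂ - (1 / 4) * ‖x‖ ^ 2 -
      (3 / 4) * ∫ y, frobeniusNormSq (fderiv ℝ (galerkinSum a x) y) := fun s x => by
    rw [hvdef, inner_galerkinRHS_eq_galerkinForm hρcont hρc ha (SliceRegular.of_contDiff hW.contDiff s) x,
      ← integral_norm_sq_galerkinSum hac has hon x]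
    exact hbound s hρ hρc (isTestFunctionOn_galerkinSum ha x) (isDivFree_galerkinSum had hdiv x)
  have hdiss : ∀ s x, ⟪v s x, x⟫ ≤ C₂ - (1 / 4) * ‖x‖ ^ 2 := fun s x =>
    (henergy s x).trans (sub_le_self _ (mul_nonneg (by norm_num)
      (integral_nonneg fun y => frobeniusNormSq_nonneg _)))
  -- the periodic solution
  obtain ⟨b, hb, hbT, hbR⟩ := Literature.Analysis.ODE.exists_periodic_solution_of_dissipative hT
    hper hlip hcont hC₂ (by norm_num : (0 : ℝ) < 1 / 4) hdiss
  have hb4 : ∀ s, ‖b s‖ ^ 2 ≤ 4 * C₂ := fun s => by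
    have h := hbR s
    have e : C₂ / (1 / 4 : ℝ) = 4 * C₂ := by ring
    linarith [h, e]
  refine ⟨b, hb, hbT, fun s => ?_, ?_⟩
  · rw [integral_norm_sq_galerkinSum hac has hon]
    exact (hb4 s).trans ((le_max_left _ _).trans (Real.le_coe_toNNReal _))
  · -- integrate the energy inequality over a period
    have hbc : Continuous b := continuous_iff_continuousAt.2 fun s => (hb s).continuousAt
    set D : ℝ → ℝ := fun s => ∫ y, frobeniusNormSq (fderiv ℝ (galerkinSum a (b s)) y) with hDdef
    have hDc : Continuous D := continuous_dissipation_galerkinSum ha hbc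
    -- `φ(s) = ‖b s‖²`, `φ' = 2⟪b, v⟫ ≤ 2C₂ - ½‖b‖² - (3/2) D`
    have hφ : ∀ s, HasDerivAt (fun s => ‖b s‖ ^ 2) (2 * ⟪b s, v s (b s)⟫) s := fun s => (hb s).norm_sq
    -- continuity of `s ↦ v s (b s)`
    set R : ℝ := Real.sqrt (4 * C₂) with hR
    have hbball : ∀ s, b s ∈ closedBall (0 : EuclideanSpace ℝ (Fin k)) R := fun s => by
      rw [mem_closedBall, dist_zero_right, hR, ← Real.sqrt_sq (norm_nonneg (b s))]
      exact Real.sqrt_le_sqrt (hb4 s)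
    obtain ⟨K, hK⟩ := hlip R
    have hvb : Continuous fun s => v s (b s) := continuous_field_comp hbc hbball hK hcont
    have hφ'c : Continuous fun s => 2 * ⟪b s, v s (b s)⟫ := continuous_const.mul (hbc.inner hvb)
    have hFTC : ∫ s in (0 : ℝ)..T, 2 * ⟪b s, v s (b s)⟫ = ‖b T‖ ^ 2 - ‖b 0‖ ^ 2 :=
      intervalIntegral.integral_eq_sub_of_hasDerivAt (fun s _ => hφ s)
        (hφ'c.intervalIntegrable _ _)
    have hper0 : ‖b T‖ ^ 2 - ‖b 0‖ ^ 2 = 0 := by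
      have := hbT 0; rw [zero_add] at this; rw [this, sub_self]
    -- pointwise: `D s ≤ (4/3) C₂ - (2/3) φ'(s)`, `φ' = 2⟪b, v⟫`
    have hpt : ∀ s, D s ≤ 4 / 3 * C₂ - (2 / 3) * (2 * ⟪b s, v s (b s)⟫) := fun s => by
      have h := henergy s (b s)
      rw [real_inner_comm] at h
      have hx : 0 ≤ ‖b s‖ ^ 2 := sq_nonneg _
      show (fun s => ∫ y, frobeniusNormSq (fderiv ℝ (galerkinSum a (b s)) y)) s ≤ _
      simp only
      linarith
    have hg : IntervalIntegrable (fun s => (2 / 3 : ℝ) * (2 * ⟪b s, v s (b s)⟫)) volume 0 T :=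
      (continuous_const.mul hφ'c).intervalIntegrable _ _
    have hf : IntervalIntegrable (fun _ : ℝ => (4 / 3 : ℝ) * C₂) volume 0 T :=
      intervalIntegrable_const
    have hrhs : ∫ s in (0 : ℝ)..T, (4 / 3 * C₂ - (2 / 3) * (2 * ⟪b s, v s (b s)⟫)) =
        T * (4 / 3 * C₂) := by
      rw [intervalIntegral.integral_sub hf hg, intervalIntegral.integral_const,
        intervalIntegral.integral_const_mul, hFTC, hper0]
      simp
    have hint : ∫ s in (0 : ℝ)..T, D s ≤ T * (4 / 3 * C₂) := by
      rw [← hrhs]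
      exact intervalIntegral.integral_mono_on hT.le (hDc.intervalIntegrable _ _) (hf.sub hg)
        fun s _ => hpt s
    calc ∫ s in (0 : ℝ)..T, D s ≤ T * (4 / 3 * C₂) := hint
      _ = 4 / 3 * C₂ * T := by ring
      _ ≤ max (4 * C₂) (4 / 3 * C₂ * T) := le_max_right _ _
      _ ≤ _ := Real.le_coe_toNNReal _

end BradshawTsai2017

end Literature.Analysis.FluidPDE
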